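import Mathlib.Analysis.SpecialFunctions.Pow.Real
import HarnessLib

/-!
# Weighted rook graphs (THEOREM R): certificates for the concordant case `v ≤ 1`

Support file for `…TwoMagnonRookWeightedCriterion` (the core inequality of THEOREM R of the theory
seat `hubbard-h0-rotor-theory-1`, ROTOR-THEORY-5 §41: two-magnon flat-overlap monotonicity on the rook
graphs `K_m □ K_n` with ARBITRARY direction weights `J₁, J₂`).  The criterion file reduces the
inequality — along the straight lines cut out by the ground-state constraint, which is affine in the
class sizes `p, q` — to the sign of two polynomials in the three variables `(u, v, J) ∈ [0,1]³` only:
`Rp′` (value at the base point `p = 1`) and `Da′` (slope there).  Both vanish to third order on the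
edge `u = v = 1`; after the blow-up `1 - v = t (1 - u)` resp. `1 - u = t (1 - v)` the quotient by the
cube of the blown-up variable has a tensor-Bernstein expansion on `[0,1]³` with nonnegative rational
coefficients.  This file records those four expansions (identities checked by `ring`, signs by
`positivity`) and assembles `0 ≤ Rp′`, `0 ≤ Da′` on the closed unit cube.  The certificates were
generated in exact rational arithmetic (prover seat hubbard-h0-rotor-p1, generation 6).
Nothing here mentions graphs or Hamiltonians; no definition is introduced.
-/

set_option linter.dupNamespace false

namespace Summit.HubbardSuperconductivity.HubbardSuperconductivity.Theorems.AnisotropyChord.TwoMagnon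

/-- Bernstein certificate for the chart `1 - v = t·(1 - u)` of `Rp′/(1-u)³`: the tensor-Bernstein form (multidegree `(3, 5, 4)`, 100 nonzero
coefficients, all positive; binomial factors absorbed) written in `x, t, J` and formal complements
`x'`, `t'`, `J'` is nonnegative when all six arguments are. [folklore] -/
theorem wrook_rpA_bernstein (x x' t t' J J' : ℝ) (hx0 : 0 ≤ x) (hx'0 : 0 ≤ x') (ht0 : 0 ≤ t) (ht'0 : 0 ≤ t') (hJ0 : 0 ≤ J) (hJ'0 : 0 ≤ J') :
    0 ≤ (x' ^ (3:ℕ)) * ((t' ^ (5:ℕ)) * ((4 : ℝ) * (J ^ (2:ℕ) * J' ^ (2:ℕ)) + (6 : ℝ) * (J ^ (3:ℕ) * J') + (2 : ℝ) * (J ^ (4:ℕ)))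
        + (t * t' ^ (4:ℕ)) * ((16 : ℝ) * (J ^ (2:ℕ) * J' ^ (2:ℕ)) + (24 : ℝ) * (J ^ (3:ℕ) * J') + (8 : ℝ) * (J ^ (4:ℕ))) + (t ^ (2:ℕ) * t' ^ (3:ℕ)) * ((2 : ℝ) * (J * J' ^ (3:ℕ))
        + (29 : ℝ) * (J ^ (2:ℕ) * J' ^ (2:ℕ)) + (40 : ℝ) * (J ^ (3:ℕ) * J') + (13 : ℝ) * (J ^ (4:ℕ))) + (t ^ (3:ℕ) * t' ^ (2:ℕ)) * ((4 : ℝ) * (J' ^ (4:ℕ))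
        + (18 : ℝ) * (J * J' ^ (3:ℕ)) + (44 : ℝ) * (J ^ (2:ℕ) * J' ^ (2:ℕ)) + (42 : ℝ) * (J ^ (3:ℕ) * J') + (12 : ℝ) * (J ^ (4:ℕ))) + (t ^ (4:ℕ) * t') * ((8 : ℝ) * (J' ^ (4:ℕ))
        + (30 : ℝ) * (J * J' ^ (3:ℕ)) + (45 : ℝ) * (J ^ (2:ℕ) * J' ^ (2:ℕ)) + (30 : ℝ) * (J ^ (3:ℕ) * J') + (7 : ℝ) * (J ^ (4:ℕ))) + (t ^ (5:ℕ)) * ((4 : ℝ) * (J' ^ (4:ℕ))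
        + (14 : ℝ) * (J * J' ^ (3:ℕ)) + (18 : ℝ) * (J ^ (2:ℕ) * J' ^ (2:ℕ)) + (10 : ℝ) * (J ^ (3:ℕ) * J') + (2 : ℝ) * (J ^ (4:ℕ))))
      + (x * x' ^ (2:ℕ)) * ((t' ^ (5:ℕ)) * ((12 : ℝ) * (J ^ (2:ℕ) * J' ^ (2:ℕ)) + (17 : ℝ) * (J ^ (3:ℕ) * J') + (6 : ℝ) * (J ^ (4:ℕ)))
          + (t * t' ^ (4:ℕ)) * ((43 : ℝ) * (J ^ (2:ℕ) * J' ^ (2:ℕ)) + (61 : ℝ) * (J ^ (3:ℕ) * J') + (23 : ℝ) * (J ^ (4:ℕ)))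
          + (t ^ (2:ℕ) * t' ^ (3:ℕ)) * ((8 : ℝ) * (J * J' ^ (3:ℕ)) + (77 : ℝ) * (J ^ (2:ℕ) * J' ^ (2:ℕ)) + (96 : ℝ) * (J ^ (3:ℕ) * J') + (37 : ℝ) * (J ^ (4:ℕ)))
          + (t ^ (3:ℕ) * t' ^ (2:ℕ)) * ((12 : ℝ) * (J' ^ (4:ℕ)) + (57 : ℝ) * (J * J' ^ (3:ℕ)) + (125 : ℝ) * (J ^ (2:ℕ) * J' ^ (2:ℕ)) + (105 : ℝ) * (J ^ (3:ℕ) * J')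
          + (35 : ℝ) * (J ^ (4:ℕ))) + (t ^ (4:ℕ) * t') * ((20 : ℝ) * (J' ^ (4:ℕ)) + (80 : ℝ) * (J * J' ^ (3:ℕ)) + (123 : ℝ) * (J ^ (2:ℕ) * J' ^ (2:ℕ))
          + (79 : ℝ) * (J ^ (3:ℕ) * J') + (21 : ℝ) * (J ^ (4:ℕ))) + (t ^ (5:ℕ)) * ((8 : ℝ) * (J' ^ (4:ℕ)) + (31 : ℝ) * (J * J' ^ (3:ℕ)) + (44 : ℝ) * (J ^ (2:ℕ) * J' ^ (2:ℕ))
          + (26 : ℝ) * (J ^ (3:ℕ) * J') + (6 : ℝ) * (J ^ (4:ℕ))))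
      + (x ^ (2:ℕ) * x') * ((t' ^ (5:ℕ)) * ((12 : ℝ) * (J ^ (2:ℕ) * J' ^ (2:ℕ)) + (16 : ℝ) * (J ^ (3:ℕ) * J') + (6 : ℝ) * (J ^ (4:ℕ)))
          + (t * t' ^ (4:ℕ)) * ((38 : ℝ) * (J ^ (2:ℕ) * J' ^ (2:ℕ)) + (52 : ℝ) * (J ^ (3:ℕ) * J') + (22 : ℝ) * (J ^ (4:ℕ)))
          + (t ^ (2:ℕ) * t' ^ (3:ℕ)) * ((10 : ℝ) * (J * J' ^ (3:ℕ)) + (69 : ℝ) * (J ^ (2:ℕ) * J' ^ (2:ℕ)) + (82 : ℝ) * (J ^ (3:ℕ) * J') + (35 : ℝ) * (J ^ (4:ℕ)))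
          + (t ^ (3:ℕ) * t' ^ (2:ℕ)) * ((12 : ℝ) * (J' ^ (4:ℕ)) + (57 : ℝ) * (J * J' ^ (3:ℕ)) + (116 : ℝ) * (J ^ (2:ℕ) * J' ^ (2:ℕ)) + (97 : ℝ) * (J ^ (3:ℕ) * J')
          + (34 : ℝ) * (J ^ (4:ℕ))) + (t ^ (4:ℕ) * t') * ((16 : ℝ) * (J' ^ (4:ℕ)) + (65 : ℝ) * (J * J' ^ (3:ℕ)) + (103 : ℝ) * (J ^ (2:ℕ) * J' ^ (2:ℕ))
          + (73 : ℝ) * (J ^ (3:ℕ) * J') + (21 : ℝ) * (J ^ (4:ℕ))) + (t ^ (5:ℕ)) * ((5 : ℝ) * (J' ^ (4:ℕ)) + (20 : ℝ) * (J * J' ^ (3:ℕ)) + (31 : ℝ) * (J ^ (2:ℕ) * J' ^ (2:ℕ))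
          + (22 : ℝ) * (J ^ (3:ℕ) * J') + (6 : ℝ) * (J ^ (4:ℕ))))
      + (x ^ (3:ℕ)) * ((t' ^ (5:ℕ)) * ((4 : ℝ) * (J ^ (2:ℕ) * J' ^ (2:ℕ)) + (5 : ℝ) * (J ^ (3:ℕ) * J') + (2 : ℝ) * (J ^ (4:ℕ)))
          + (t * t' ^ (4:ℕ)) * ((11 : ℝ) * (J ^ (2:ℕ) * J' ^ (2:ℕ)) + (15 : ℝ) * (J ^ (3:ℕ) * J') + (7 : ℝ) * (J ^ (4:ℕ)))
          + (t ^ (2:ℕ) * t' ^ (3:ℕ)) * ((4 : ℝ) * (J * J' ^ (3:ℕ)) + (21 : ℝ) * (J ^ (2:ℕ) * J' ^ (2:ℕ)) + (25 : ℝ) * (J ^ (3:ℕ) * J') + (11 : ℝ) * (J ^ (4:ℕ)))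
          + (t ^ (3:ℕ) * t' ^ (2:ℕ)) * ((4 : ℝ) * (J' ^ (4:ℕ)) + (18 : ℝ) * (J * J' ^ (3:ℕ)) + (35 : ℝ) * (J ^ (2:ℕ) * J' ^ (2:ℕ)) + (31 : ℝ) * (J ^ (3:ℕ) * J')
          + (11 : ℝ) * (J ^ (4:ℕ))) + (t ^ (4:ℕ) * t') * ((4 : ℝ) * (J' ^ (4:ℕ)) + (16 : ℝ) * (J * J' ^ (3:ℕ)) + (27 : ℝ) * (J ^ (2:ℕ) * J' ^ (2:ℕ)) + (22 : ℝ) * (J ^ (3:ℕ) * J')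
          + (7 : ℝ) * (J ^ (4:ℕ))) + (t ^ (5:ℕ)) * ((1 : ℝ) * (J' ^ (4:ℕ)) + (4 : ℝ) * (J * J' ^ (3:ℕ)) + (7 : ℝ) * (J ^ (2:ℕ) * J' ^ (2:ℕ)) + (6 : ℝ) * (J ^ (3:ℕ) * J')
          + (2 : ℝ) * (J ^ (4:ℕ)))) := by
  positivity

/-- the chart `1 - v = t·(1 - u)` of `Rp′/(1-u)³` is nonnegative on the unit cube: the polynomial equals its Bernstein form
(`wrook_rpA_bernstein`) at the complements `x' = 1 - x`, `t' = 1 - t`, `J' = 1 - J` (identity by `ring`). [folklore] -/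
theorem wrook_rpA_nonneg (x t J : ℝ) (hx0 : 0 ≤ x) (hx1 : x ≤ 1) (ht0 : 0 ≤ t) (ht1 : t ≤ 1) (hJ0 : 0 ≤ J) (hJ1 : J ≤ 1) :
    0 ≤ (4 : ℝ) * J ^ (2:ℕ) + (2 : ℝ) * J * t ^ (2:ℕ) - (4 : ℝ) * J ^ (2:ℕ) * t - (2 : ℝ) * J ^ (3:ℕ) + (4 : ℝ) * t ^ (3:ℕ) + (2 : ℝ) * J * t ^ (2:ℕ) * x
        - (4 : ℝ) * J * t ^ (3:ℕ) - (5 : ℝ) * J ^ (2:ℕ) * t * x - J ^ (2:ℕ) * t ^ (2:ℕ) + (2 : ℝ) * J ^ (3:ℕ) * t - J ^ (3:ℕ) * x - (3 : ℝ) * J * t ^ (3:ℕ) * x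
        + (4 : ℝ) * J ^ (2:ℕ) * t ^ (2:ℕ) * x + J ^ (2:ℕ) * t ^ (3:ℕ) + (4 : ℝ) * J ^ (3:ℕ) * t * x + J ^ (4:ℕ) * x - (4 : ℝ) * t ^ (4:ℕ) * x
        - (3 : ℝ) * J * t ^ (3:ℕ) * x ^ (2:ℕ) + (6 : ℝ) * J * t ^ (4:ℕ) * x + (2 : ℝ) * J ^ (2:ℕ) * t ^ (2:ℕ) * x ^ (2:ℕ) + (2 : ℝ) * J ^ (2:ℕ) * t ^ (3:ℕ) * x
        + (2 : ℝ) * J ^ (3:ℕ) * t * x ^ (2:ℕ) - (4 : ℝ) * J ^ (3:ℕ) * t ^ (2:ℕ) * x + J * t ^ (4:ℕ) * x ^ (2:ℕ) + J ^ (2:ℕ) * t ^ (3:ℕ) * x ^ (2:ℕ)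
        - (2 : ℝ) * J ^ (2:ℕ) * t ^ (4:ℕ) * x - (2 : ℝ) * J ^ (3:ℕ) * t ^ (2:ℕ) * x ^ (2:ℕ) - (2 : ℝ) * J ^ (4:ℕ) * t * x ^ (2:ℕ) + t ^ (5:ℕ) * x ^ (2:ℕ)
        + J * t ^ (4:ℕ) * x ^ (3:ℕ) - (2 : ℝ) * J * t ^ (5:ℕ) * x ^ (2:ℕ) - J ^ (2:ℕ) * t ^ (4:ℕ) * x ^ (2:ℕ) - J ^ (3:ℕ) * t ^ (2:ℕ) * x ^ (3:ℕ)
        + (2 : ℝ) * J ^ (3:ℕ) * t ^ (3:ℕ) * x ^ (2:ℕ) - J ^ (2:ℕ) * t ^ (4:ℕ) * x ^ (3:ℕ) + J ^ (2:ℕ) * t ^ (5:ℕ) * x ^ (2:ℕ) + J ^ (4:ℕ) * t ^ (2:ℕ) * x ^ (3:ℕ) :=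
  (wrook_rpA_bernstein x (1 - x) t (1 - t) J (1 - J) hx0 (by linarith) ht0 (by linarith) hJ0 (by linarith)).trans_eq (by ring)

/-- Bernstein certificate for the chart `1 - u = t·(1 - v)` of `Rp′/(1-v)³`: the tensor-Bernstein form (multidegree `(4, 3, 4)`, 100 nonzero
coefficients, all positive; binomial factors absorbed) written in `t, y, J` and formal complements
`t'`, `y'`, `J'` is nonnegative when all six arguments are. [folklore] -/
theorem wrook_rpB_bernstein (t t' y y' J J' : ℝ) (ht0 : 0 ≤ t) (ht'0 : 0 ≤ t') (hy0 : 0 ≤ y) (hy'0 : 0 ≤ y') (hJ0 : 0 ≤ J) (hJ'0 : 0 ≤ J') :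
    0 ≤ (t' ^ (4:ℕ)) * ((y' ^ (3:ℕ)) * ((4 : ℝ) * (J' ^ (4:ℕ)) + (12 : ℝ) * (J * J' ^ (3:ℕ)) + (13 : ℝ) * (J ^ (2:ℕ) * J' ^ (2:ℕ)) + (6 : ℝ) * (J ^ (3:ℕ) * J')
        + (1 : ℝ) * (J ^ (4:ℕ))) + (y * y' ^ (2:ℕ)) * ((8 : ℝ) * (J' ^ (4:ℕ)) + (26 : ℝ) * (J * J' ^ (3:ℕ)) + (31 : ℝ) * (J ^ (2:ℕ) * J' ^ (2:ℕ)) + (16 : ℝ) * (J ^ (3:ℕ) * J')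
        + (3 : ℝ) * (J ^ (4:ℕ))) + (y ^ (2:ℕ) * y') * ((5 : ℝ) * (J' ^ (4:ℕ)) + (18 : ℝ) * (J * J' ^ (3:ℕ)) + (24 : ℝ) * (J ^ (2:ℕ) * J' ^ (2:ℕ)) + (14 : ℝ) * (J ^ (3:ℕ) * J')
        + (3 : ℝ) * (J ^ (4:ℕ))) + (y ^ (3:ℕ)) * ((1 : ℝ) * (J' ^ (4:ℕ)) + (4 : ℝ) * (J * J' ^ (3:ℕ)) + (6 : ℝ) * (J ^ (2:ℕ) * J' ^ (2:ℕ)) + (4 : ℝ) * (J ^ (3:ℕ) * J')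
        + (1 : ℝ) * (J ^ (4:ℕ))))
      + (t * t' ^ (3:ℕ)) * ((y' ^ (3:ℕ)) * ((16 : ℝ) * (J' ^ (4:ℕ)) + (50 : ℝ) * (J * J' ^ (3:ℕ)) + (57 : ℝ) * (J ^ (2:ℕ) * J' ^ (2:ℕ)) + (28 : ℝ) * (J ^ (3:ℕ) * J')
          + (5 : ℝ) * (J ^ (4:ℕ))) + (y * y' ^ (2:ℕ)) * ((32 : ℝ) * (J' ^ (4:ℕ)) + (107 : ℝ) * (J * J' ^ (3:ℕ)) + (132 : ℝ) * (J ^ (2:ℕ) * J' ^ (2:ℕ))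
          + (71 : ℝ) * (J ^ (3:ℕ) * J') + (14 : ℝ) * (J ^ (4:ℕ))) + (y ^ (2:ℕ) * y') * ((20 : ℝ) * (J' ^ (4:ℕ)) + (73 : ℝ) * (J * J' ^ (3:ℕ))
          + (99 : ℝ) * (J ^ (2:ℕ) * J' ^ (2:ℕ)) + (59 : ℝ) * (J ^ (3:ℕ) * J') + (13 : ℝ) * (J ^ (4:ℕ))) + (y ^ (3:ℕ)) * ((4 : ℝ) * (J' ^ (4:ℕ)) + (16 : ℝ) * (J * J' ^ (3:ℕ))
          + (24 : ℝ) * (J ^ (2:ℕ) * J' ^ (2:ℕ)) + (16 : ℝ) * (J ^ (3:ℕ) * J') + (4 : ℝ) * (J ^ (4:ℕ))))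
      + (t ^ (2:ℕ) * t' ^ (2:ℕ)) * ((y' ^ (3:ℕ)) * ((24 : ℝ) * (J' ^ (4:ℕ)) + (78 : ℝ) * (J * J' ^ (3:ℕ)) + (89 : ℝ) * (J ^ (2:ℕ) * J' ^ (2:ℕ)) + (42 : ℝ) * (J ^ (3:ℕ) * J')
          + (7 : ℝ) * (J ^ (4:ℕ))) + (y * y' ^ (2:ℕ)) * ((48 : ℝ) * (J' ^ (4:ℕ)) + (167 : ℝ) * (J * J' ^ (3:ℕ)) + (208 : ℝ) * (J ^ (2:ℕ) * J' ^ (2:ℕ))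
          + (109 : ℝ) * (J ^ (3:ℕ) * J') + (20 : ℝ) * (J ^ (4:ℕ))) + (y ^ (2:ℕ) * y') * ((30 : ℝ) * (J' ^ (4:ℕ)) + (112 : ℝ) * (J * J' ^ (3:ℕ))
          + (153 : ℝ) * (J ^ (2:ℕ) * J' ^ (2:ℕ)) + (90 : ℝ) * (J ^ (3:ℕ) * J') + (19 : ℝ) * (J ^ (4:ℕ))) + (y ^ (3:ℕ)) * ((6 : ℝ) * (J' ^ (4:ℕ)) + (24 : ℝ) * (J * J' ^ (3:ℕ))
          + (36 : ℝ) * (J ^ (2:ℕ) * J' ^ (2:ℕ)) + (24 : ℝ) * (J ^ (3:ℕ) * J') + (6 : ℝ) * (J ^ (4:ℕ))))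
      + (t ^ (3:ℕ) * t') * ((y' ^ (3:ℕ)) * ((16 : ℝ) * (J' ^ (4:ℕ)) + (54 : ℝ) * (J * J' ^ (3:ℕ)) + (63 : ℝ) * (J ^ (2:ℕ) * J' ^ (2:ℕ)) + (30 : ℝ) * (J ^ (3:ℕ) * J')
          + (5 : ℝ) * (J ^ (4:ℕ))) + (y * y' ^ (2:ℕ)) * ((32 : ℝ) * (J' ^ (4:ℕ)) + (117 : ℝ) * (J * J' ^ (3:ℕ)) + (151 : ℝ) * (J ^ (2:ℕ) * J' ^ (2:ℕ))
          + (81 : ℝ) * (J ^ (3:ℕ) * J') + (15 : ℝ) * (J ^ (4:ℕ))) + (y ^ (2:ℕ) * y') * ((20 : ℝ) * (J' ^ (4:ℕ)) + (77 : ℝ) * (J * J' ^ (3:ℕ))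
          + (109 : ℝ) * (J ^ (2:ℕ) * J' ^ (2:ℕ)) + (67 : ℝ) * (J ^ (3:ℕ) * J') + (15 : ℝ) * (J ^ (4:ℕ))) + (y ^ (3:ℕ)) * ((4 : ℝ) * (J' ^ (4:ℕ)) + (16 : ℝ) * (J * J' ^ (3:ℕ))
          + (25 : ℝ) * (J ^ (2:ℕ) * J' ^ (2:ℕ)) + (18 : ℝ) * (J ^ (3:ℕ) * J') + (5 : ℝ) * (J ^ (4:ℕ))))
      + (t ^ (4:ℕ)) * ((y' ^ (3:ℕ)) * ((4 : ℝ) * (J' ^ (4:ℕ)) + (14 : ℝ) * (J * J' ^ (3:ℕ)) + (18 : ℝ) * (J ^ (2:ℕ) * J' ^ (2:ℕ)) + (10 : ℝ) * (J ^ (3:ℕ) * J')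
          + (2 : ℝ) * (J ^ (4:ℕ))) + (y * y' ^ (2:ℕ)) * ((8 : ℝ) * (J' ^ (4:ℕ)) + (31 : ℝ) * (J * J' ^ (3:ℕ)) + (44 : ℝ) * (J ^ (2:ℕ) * J' ^ (2:ℕ)) + (26 : ℝ) * (J ^ (3:ℕ) * J')
          + (6 : ℝ) * (J ^ (4:ℕ))) + (y ^ (2:ℕ) * y') * ((5 : ℝ) * (J' ^ (4:ℕ)) + (20 : ℝ) * (J * J' ^ (3:ℕ)) + (31 : ℝ) * (J ^ (2:ℕ) * J' ^ (2:ℕ)) + (22 : ℝ) * (J ^ (3:ℕ) * J')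
          + (6 : ℝ) * (J ^ (4:ℕ))) + (y ^ (3:ℕ)) * ((1 : ℝ) * (J' ^ (4:ℕ)) + (4 : ℝ) * (J * J' ^ (3:ℕ)) + (7 : ℝ) * (J ^ (2:ℕ) * J' ^ (2:ℕ)) + (6 : ℝ) * (J ^ (3:ℕ) * J')
          + (2 : ℝ) * (J ^ (4:ℕ)))) := by
  positivity

/-- the chart `1 - u = t·(1 - v)` of `Rp′/(1-v)³` is nonnegative on the unit cube: the polynomial equals its Bernstein form
(`wrook_rpB_bernstein`) at the complements `t' = 1 - t`, `y' = 1 - y`, `J' = 1 - J` (identity by `ring`). [folklore] -/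
theorem wrook_rpB_nonneg (t y J : ℝ) (ht0 : 0 ≤ t) (ht1 : t ≤ 1) (hy0 : 0 ≤ y) (hy1 : y ≤ 1) (hJ0 : 0 ≤ J) (hJ1 : J ≤ 1) :
    0 ≤ (4 : ℝ) - (4 : ℝ) * J - (4 : ℝ) * y + (2 : ℝ) * J * t + (6 : ℝ) * J * y + J ^ (2:ℕ) + y ^ (2:ℕ) - (3 : ℝ) * J * t * y - (2 : ℝ) * J * y ^ (2:ℕ) - J ^ (2:ℕ) * t
        - (2 : ℝ) * J ^ (2:ℕ) * y + J * t * y ^ (2:ℕ) + (2 : ℝ) * J * t ^ (2:ℕ) * y + (2 : ℝ) * J ^ (2:ℕ) * t * y - (4 : ℝ) * J ^ (2:ℕ) * t ^ (2:ℕ) + J ^ (2:ℕ) * y ^ (2:ℕ)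
        - (3 : ℝ) * J * t ^ (2:ℕ) * y ^ (2:ℕ) - J ^ (2:ℕ) * t * y ^ (2:ℕ) + (4 : ℝ) * J ^ (2:ℕ) * t ^ (2:ℕ) * y + (4 : ℝ) * J ^ (2:ℕ) * t ^ (3:ℕ)
        + (2 : ℝ) * J ^ (3:ℕ) * t ^ (2:ℕ) + J * t ^ (2:ℕ) * y ^ (3:ℕ) + J ^ (2:ℕ) * t ^ (2:ℕ) * y ^ (2:ℕ) - (5 : ℝ) * J ^ (2:ℕ) * t ^ (3:ℕ) * y
        - (4 : ℝ) * J ^ (3:ℕ) * t ^ (2:ℕ) * y - (2 : ℝ) * J ^ (3:ℕ) * t ^ (3:ℕ) - J ^ (2:ℕ) * t ^ (2:ℕ) * y ^ (3:ℕ) + (2 : ℝ) * J ^ (2:ℕ) * t ^ (3:ℕ) * y ^ (2:ℕ)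
        + (2 : ℝ) * J ^ (3:ℕ) * t ^ (2:ℕ) * y ^ (2:ℕ) + (4 : ℝ) * J ^ (3:ℕ) * t ^ (3:ℕ) * y - (2 : ℝ) * J ^ (3:ℕ) * t ^ (3:ℕ) * y ^ (2:ℕ) - J ^ (3:ℕ) * t ^ (4:ℕ) * y
        + (2 : ℝ) * J ^ (3:ℕ) * t ^ (4:ℕ) * y ^ (2:ℕ) + J ^ (4:ℕ) * t ^ (4:ℕ) * y - J ^ (3:ℕ) * t ^ (4:ℕ) * y ^ (3:ℕ) - (2 : ℝ) * J ^ (4:ℕ) * t ^ (4:ℕ) * y ^ (2:ℕ)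
        + J ^ (4:ℕ) * t ^ (4:ℕ) * y ^ (3:ℕ) :=
  (wrook_rpB_bernstein t (1 - t) y (1 - y) J (1 - J) ht0 (by linarith) hy0 (by linarith) hJ0 (by linarith)).trans_eq (by ring)

/-- Bernstein certificate for the chart `1 - v = t·(1 - u)` of `Da′/(1-u)³`: the tensor-Bernstein form (multidegree `(2, 4, 3)`, 45 nonzero
coefficients, all positive; binomial factors absorbed) written in `x, t, J` and formal complements
`x'`, `t'`, `J'` is nonnegative when all six arguments are. [folklore] -/
theorem wrook_daA_bernstein (x x' t t' J J' : ℝ) (hx0 : 0 ≤ x) (hx'0 : 0 ≤ x') (ht0 : 0 ≤ t) (ht'0 : 0 ≤ t') (hJ0 : 0 ≤ J) (hJ'0 : 0 ≤ J') :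
    0 ≤ (x' ^ (2:ℕ)) * ((t' ^ (4:ℕ)) * ((4 : ℝ) * (J ^ (2:ℕ) * J') + (3 : ℝ) * (J ^ (3:ℕ))) + (t * t' ^ (3:ℕ)) * ((14 : ℝ) * (J ^ (2:ℕ) * J') + (10 : ℝ) * (J ^ (3:ℕ)))
        + (t ^ (2:ℕ) * t' ^ (2:ℕ)) * ((1 : ℝ) * (J * J' ^ (2:ℕ)) + (20 : ℝ) * (J ^ (2:ℕ) * J') + (13 : ℝ) * (J ^ (3:ℕ))) + (t ^ (3:ℕ) * t') * ((4 : ℝ) * (J' ^ (3:ℕ))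
        + (12 : ℝ) * (J * J' ^ (2:ℕ)) + (22 : ℝ) * (J ^ (2:ℕ) * J') + (10 : ℝ) * (J ^ (3:ℕ))) + (t ^ (4:ℕ)) * ((4 : ℝ) * (J' ^ (3:ℕ)) + (11 : ℝ) * (J * J' ^ (2:ℕ))
        + (12 : ℝ) * (J ^ (2:ℕ) * J') + (4 : ℝ) * (J ^ (3:ℕ))))
      + (x * x') * ((t' ^ (4:ℕ)) * ((8 : ℝ) * (J ^ (2:ℕ) * J') + (6 : ℝ) * (J ^ (3:ℕ))) + (t * t' ^ (3:ℕ)) * ((25 : ℝ) * (J ^ (2:ℕ) * J') + (19 : ℝ) * (J ^ (3:ℕ)))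
          + (t ^ (2:ℕ) * t' ^ (2:ℕ)) * ((3 : ℝ) * (J * J' ^ (2:ℕ)) + (34 : ℝ) * (J ^ (2:ℕ) * J') + (25 : ℝ) * (J ^ (3:ℕ))) + (t ^ (3:ℕ) * t') * ((8 : ℝ) * (J' ^ (3:ℕ))
          + (25 : ℝ) * (J * J' ^ (2:ℕ)) + (39 : ℝ) * (J ^ (2:ℕ) * J') + (20 : ℝ) * (J ^ (3:ℕ))) + (t ^ (4:ℕ)) * ((6 : ℝ) * (J' ^ (3:ℕ)) + (18 : ℝ) * (J * J' ^ (2:ℕ))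
          + (20 : ℝ) * (J ^ (2:ℕ) * J') + (8 : ℝ) * (J ^ (3:ℕ))))
      + (x ^ (2:ℕ)) * ((t' ^ (4:ℕ)) * ((4 : ℝ) * (J ^ (2:ℕ) * J') + (3 : ℝ) * (J ^ (3:ℕ))) + (t * t' ^ (3:ℕ)) * ((11 : ℝ) * (J ^ (2:ℕ) * J') + (9 : ℝ) * (J ^ (3:ℕ)))
          + (t ^ (2:ℕ) * t' ^ (2:ℕ)) * ((2 : ℝ) * (J * J' ^ (2:ℕ)) + (15 : ℝ) * (J ^ (2:ℕ) * J') + (12 : ℝ) * (J ^ (3:ℕ))) + (t ^ (3:ℕ) * t') * ((4 : ℝ) * (J' ^ (3:ℕ))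
          + (12 : ℝ) * (J * J' ^ (2:ℕ)) + (18 : ℝ) * (J ^ (2:ℕ) * J') + (10 : ℝ) * (J ^ (3:ℕ))) + (t ^ (4:ℕ)) * ((2 : ℝ) * (J' ^ (3:ℕ)) + (6 : ℝ) * (J * J' ^ (2:ℕ))
          + (8 : ℝ) * (J ^ (2:ℕ) * J') + (4 : ℝ) * (J ^ (3:ℕ)))) := by
  positivity

/-- the chart `1 - v = t·(1 - u)` of `Da′/(1-u)³` is nonnegative on the unit cube: the polynomial equals its Bernstein form
(`wrook_daA_bernstein`) at the complements `x' = 1 - x`, `t' = 1 - t`, `J' = 1 - J` (identity by `ring`). [folklore] -/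
theorem wrook_daA_nonneg (x t J : ℝ) (hx0 : 0 ≤ x) (hx1 : x ≤ 1) (ht0 : 0 ≤ t) (ht1 : t ≤ 1) (hJ0 : 0 ≤ J) (hJ1 : J ≤ 1) :
    0 ≤ (4 : ℝ) * J ^ (2:ℕ) + J * t ^ (2:ℕ) - (2 : ℝ) * J ^ (2:ℕ) * t - J ^ (3:ℕ) + (4 : ℝ) * t ^ (3:ℕ) + J * t ^ (2:ℕ) * x - (2 : ℝ) * J * t ^ (3:ℕ)
        - (3 : ℝ) * J ^ (2:ℕ) * t * x - J * t ^ (3:ℕ) * x + J ^ (2:ℕ) * t ^ (2:ℕ) * x + (2 : ℝ) * J ^ (3:ℕ) * t * x - (2 : ℝ) * t ^ (4:ℕ) * x - J * t ^ (3:ℕ) * x ^ (2:ℕ)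
        + (2 : ℝ) * J * t ^ (4:ℕ) * x + J ^ (2:ℕ) * t ^ (2:ℕ) * x ^ (2:ℕ) + J ^ (2:ℕ) * t ^ (3:ℕ) * x ^ (2:ℕ) - J ^ (3:ℕ) * t ^ (2:ℕ) * x ^ (2:ℕ) :=
  (wrook_daA_bernstein x (1 - x) t (1 - t) J (1 - J) hx0 (by linarith) ht0 (by linarith) hJ0 (by linarith)).trans_eq (by ring)

/-- Bernstein certificate for the chart `1 - u = t·(1 - v)` of `Da′/(1-v)³`: the tensor-Bernstein form (multidegree `(3, 2, 3)`, 48 nonzero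
coefficients, all positive; binomial factors absorbed) written in `t, y, J` and formal complements
`t'`, `y'`, `J'` is nonnegative when all six arguments are. [folklore] -/
theorem wrook_daB_bernstein (t t' y y' J J' : ℝ) (ht0 : 0 ≤ t) (ht'0 : 0 ≤ t') (hy0 : 0 ≤ y) (hy'0 : 0 ≤ y') (hJ0 : 0 ≤ J) (hJ'0 : 0 ≤ J') :
    0 ≤ (t' ^ (3:ℕ)) * ((y' ^ (2:ℕ)) * ((4 : ℝ) * (J' ^ (3:ℕ)) + (10 : ℝ) * (J * J' ^ (2:ℕ)) + (8 : ℝ) * (J ^ (2:ℕ) * J') + (2 : ℝ) * (J ^ (3:ℕ)))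
        + (y * y') * ((6 : ℝ) * (J' ^ (3:ℕ)) + (16 : ℝ) * (J * J' ^ (2:ℕ)) + (14 : ℝ) * (J ^ (2:ℕ) * J') + (4 : ℝ) * (J ^ (3:ℕ))) + (y ^ (2:ℕ)) * ((2 : ℝ) * (J' ^ (3:ℕ))
        + (6 : ℝ) * (J * J' ^ (2:ℕ)) + (6 : ℝ) * (J ^ (2:ℕ) * J') + (2 : ℝ) * (J ^ (3:ℕ))))
      + (t * t' ^ (2:ℕ)) * ((y' ^ (2:ℕ)) * ((12 : ℝ) * (J' ^ (3:ℕ)) + (31 : ℝ) * (J * J' ^ (2:ℕ)) + (26 : ℝ) * (J ^ (2:ℕ) * J') + (7 : ℝ) * (J ^ (3:ℕ)))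
          + (y * y') * ((18 : ℝ) * (J' ^ (3:ℕ)) + (49 : ℝ) * (J * J' ^ (2:ℕ)) + (44 : ℝ) * (J ^ (2:ℕ) * J') + (13 : ℝ) * (J ^ (3:ℕ))) + (y ^ (2:ℕ)) * ((6 : ℝ) * (J' ^ (3:ℕ))
          + (18 : ℝ) * (J * J' ^ (2:ℕ)) + (18 : ℝ) * (J ^ (2:ℕ) * J') + (6 : ℝ) * (J ^ (3:ℕ))))
      + (t ^ (2:ℕ) * t') * ((y' ^ (2:ℕ)) * ((12 : ℝ) * (J' ^ (3:ℕ)) + (32 : ℝ) * (J * J' ^ (2:ℕ)) + (26 : ℝ) * (J ^ (2:ℕ) * J') + (6 : ℝ) * (J ^ (3:ℕ)))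
          + (y * y') * ((18 : ℝ) * (J' ^ (3:ℕ)) + (51 : ℝ) * (J * J' ^ (2:ℕ)) + (45 : ℝ) * (J ^ (2:ℕ) * J') + (12 : ℝ) * (J ^ (3:ℕ))) + (y ^ (2:ℕ)) * ((6 : ℝ) * (J' ^ (3:ℕ))
          + (18 : ℝ) * (J * J' ^ (2:ℕ)) + (18 : ℝ) * (J ^ (2:ℕ) * J') + (6 : ℝ) * (J ^ (3:ℕ))))
      + (t ^ (3:ℕ)) * ((y' ^ (2:ℕ)) * ((4 : ℝ) * (J' ^ (3:ℕ)) + (11 : ℝ) * (J * J' ^ (2:ℕ)) + (12 : ℝ) * (J ^ (2:ℕ) * J') + (4 : ℝ) * (J ^ (3:ℕ)))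
          + (y * y') * ((6 : ℝ) * (J' ^ (3:ℕ)) + (18 : ℝ) * (J * J' ^ (2:ℕ)) + (20 : ℝ) * (J ^ (2:ℕ) * J') + (8 : ℝ) * (J ^ (3:ℕ))) + (y ^ (2:ℕ)) * ((2 : ℝ) * (J' ^ (3:ℕ))
          + (6 : ℝ) * (J * J' ^ (2:ℕ)) + (8 : ℝ) * (J ^ (2:ℕ) * J') + (4 : ℝ) * (J ^ (3:ℕ)))) := by
  positivity

/-- the chart `1 - u = t·(1 - v)` of `Da′/(1-v)³` is nonnegative on the unit cube: the polynomial equals its Bernstein form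
(`wrook_daB_bernstein`) at the complements `t' = 1 - t`, `y' = 1 - y`, `J' = 1 - J` (identity by `ring`). [folklore] -/
theorem wrook_daB_nonneg (t y J : ℝ) (ht0 : 0 ≤ t) (ht1 : t ≤ 1) (hy0 : 0 ≤ y) (hy1 : y ≤ 1) (hJ0 : 0 ≤ J) (hJ1 : J ≤ 1) :
    0 ≤ (4 : ℝ) - (2 : ℝ) * J - (2 : ℝ) * y + J * t + (2 : ℝ) * J * y - J * t * y + J * t ^ (2:ℕ) * y - (2 : ℝ) * J ^ (2:ℕ) * t ^ (2:ℕ) - J * t ^ (2:ℕ) * y ^ (2:ℕ)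
        + J ^ (2:ℕ) * t ^ (2:ℕ) * y + (4 : ℝ) * J ^ (2:ℕ) * t ^ (3:ℕ) + J ^ (2:ℕ) * t ^ (2:ℕ) * y ^ (2:ℕ) - (3 : ℝ) * J ^ (2:ℕ) * t ^ (3:ℕ) * y - J ^ (3:ℕ) * t ^ (3:ℕ)
        + J ^ (2:ℕ) * t ^ (3:ℕ) * y ^ (2:ℕ) + (2 : ℝ) * J ^ (3:ℕ) * t ^ (3:ℕ) * y - J ^ (3:ℕ) * t ^ (3:ℕ) * y ^ (2:ℕ) :=
  (wrook_daB_bernstein t (1 - t) y (1 - y) J (1 - J) ht0 (by linarith) hy0 (by linarith) hJ0 (by linarith)).trans_eq (by ring)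

/-- `Rp′` in the blown-down variables `x = 1 - u`, `y = 1 - v` is nonnegative on the unit cube:
if `y ≤ x` use the chart `y = t·x` (`wrook_rpA_nonneg`, factor `x³ ≥ 0`), otherwise the chart `x = t·y`
(`wrook_rpB_nonneg`, factor `y³ ≥ 0`). [folklore] -/
theorem wrook_rp_xy_nonneg (x y J : ℝ) (hx0 : 0 ≤ x) (hx1 : x ≤ 1) (hy0 : 0 ≤ y) (hy1 : y ≤ 1)
    (hJ0 : 0 ≤ J) (hJ1 : J ≤ 1) :
    0 ≤ (4 : ℝ) * y ^ (3:ℕ) + (2 : ℝ) * J * x * y ^ (2:ℕ) - (4 : ℝ) * J * y ^ (3:ℕ) - (4 : ℝ) * y ^ (4:ℕ) - (3 : ℝ) * J * x * y ^ (3:ℕ) + (2 : ℝ) * J * x ^ (2:ℕ) * y ^ (2:ℕ)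
        + (6 : ℝ) * J * y ^ (4:ℕ) - J ^ (2:ℕ) * x * y ^ (2:ℕ) - (4 : ℝ) * J ^ (2:ℕ) * x ^ (2:ℕ) * y + (4 : ℝ) * J ^ (2:ℕ) * x ^ (3:ℕ) + J ^ (2:ℕ) * y ^ (3:ℕ) + y ^ (5:ℕ)
        + J * x * y ^ (4:ℕ) - (3 : ℝ) * J * x ^ (2:ℕ) * y ^ (3:ℕ) - (2 : ℝ) * J * y ^ (5:ℕ) + (2 : ℝ) * J ^ (2:ℕ) * x * y ^ (3:ℕ) + (4 : ℝ) * J ^ (2:ℕ) * x ^ (2:ℕ) * y ^ (2:ℕ)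
        - (5 : ℝ) * J ^ (2:ℕ) * x ^ (3:ℕ) * y - (2 : ℝ) * J ^ (2:ℕ) * y ^ (4:ℕ) + (2 : ℝ) * J ^ (3:ℕ) * x ^ (2:ℕ) * y - (2 : ℝ) * J ^ (3:ℕ) * x ^ (3:ℕ)
        + J * x ^ (2:ℕ) * y ^ (4:ℕ) - J ^ (2:ℕ) * x * y ^ (4:ℕ) + J ^ (2:ℕ) * x ^ (2:ℕ) * y ^ (3:ℕ) + (2 : ℝ) * J ^ (2:ℕ) * x ^ (3:ℕ) * y ^ (2:ℕ) + J ^ (2:ℕ) * y ^ (5:ℕ)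
        - (4 : ℝ) * J ^ (3:ℕ) * x ^ (2:ℕ) * y ^ (2:ℕ) + (4 : ℝ) * J ^ (3:ℕ) * x ^ (3:ℕ) * y - J ^ (3:ℕ) * x ^ (4:ℕ) - J ^ (2:ℕ) * x ^ (2:ℕ) * y ^ (4:ℕ)
        + (2 : ℝ) * J ^ (3:ℕ) * x ^ (2:ℕ) * y ^ (3:ℕ) - (2 : ℝ) * J ^ (3:ℕ) * x ^ (3:ℕ) * y ^ (2:ℕ) + (2 : ℝ) * J ^ (3:ℕ) * x ^ (4:ℕ) * y + J ^ (4:ℕ) * x ^ (4:ℕ)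
        - J ^ (3:ℕ) * x ^ (4:ℕ) * y ^ (2:ℕ) - (2 : ℝ) * J ^ (4:ℕ) * x ^ (4:ℕ) * y + J ^ (4:ℕ) * x ^ (4:ℕ) * y ^ (2:ℕ) := by
  rcases le_total y x with hyx | hxy
  · rcases eq_or_lt_of_le hx0 with hx | hx
    · have hy : y = 0 := le_antisymm (hx ▸ hyx) hy0
      subst hy; rw [← hx]; norm_num
    · have ht0 : 0 ≤ y / x := div_nonneg hy0 hx0
      have ht1 : y / x ≤ 1 := (div_le_one hx).mpr hyx
      have h := wrook_rpA_nonneg x (y / x) J hx0 hx1 ht0 ht1 hJ0 hJ1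
      have key : (4 : ℝ) * y ^ (3:ℕ) + (2 : ℝ) * J * x * y ^ (2:ℕ) - (4 : ℝ) * J * y ^ (3:ℕ) - (4 : ℝ) * y ^ (4:ℕ) - (3 : ℝ) * J * x * y ^ (3:ℕ)
          + (2 : ℝ) * J * x ^ (2:ℕ) * y ^ (2:ℕ) + (6 : ℝ) * J * y ^ (4:ℕ) - J ^ (2:ℕ) * x * y ^ (2:ℕ) - (4 : ℝ) * J ^ (2:ℕ) * x ^ (2:ℕ) * y + (4 : ℝ) * J ^ (2:ℕ) * x ^ (3:ℕ)
          + J ^ (2:ℕ) * y ^ (3:ℕ) + y ^ (5:ℕ) + J * x * y ^ (4:ℕ) - (3 : ℝ) * J * x ^ (2:ℕ) * y ^ (3:ℕ) - (2 : ℝ) * J * y ^ (5:ℕ) + (2 : ℝ) * J ^ (2:ℕ) * x * y ^ (3:ℕ)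
          + (4 : ℝ) * J ^ (2:ℕ) * x ^ (2:ℕ) * y ^ (2:ℕ) - (5 : ℝ) * J ^ (2:ℕ) * x ^ (3:ℕ) * y - (2 : ℝ) * J ^ (2:ℕ) * y ^ (4:ℕ) + (2 : ℝ) * J ^ (3:ℕ) * x ^ (2:ℕ) * y
          - (2 : ℝ) * J ^ (3:ℕ) * x ^ (3:ℕ) + J * x ^ (2:ℕ) * y ^ (4:ℕ) - J ^ (2:ℕ) * x * y ^ (4:ℕ) + J ^ (2:ℕ) * x ^ (2:ℕ) * y ^ (3:ℕ)
          + (2 : ℝ) * J ^ (2:ℕ) * x ^ (3:ℕ) * y ^ (2:ℕ) + J ^ (2:ℕ) * y ^ (5:ℕ) - (4 : ℝ) * J ^ (3:ℕ) * x ^ (2:ℕ) * y ^ (2:ℕ) + (4 : ℝ) * J ^ (3:ℕ) * x ^ (3:ℕ) * y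
          - J ^ (3:ℕ) * x ^ (4:ℕ) - J ^ (2:ℕ) * x ^ (2:ℕ) * y ^ (4:ℕ) + (2 : ℝ) * J ^ (3:ℕ) * x ^ (2:ℕ) * y ^ (3:ℕ) - (2 : ℝ) * J ^ (3:ℕ) * x ^ (3:ℕ) * y ^ (2:ℕ)
          + (2 : ℝ) * J ^ (3:ℕ) * x ^ (4:ℕ) * y + J ^ (4:ℕ) * x ^ (4:ℕ) - J ^ (3:ℕ) * x ^ (4:ℕ) * y ^ (2:ℕ) - (2 : ℝ) * J ^ (4:ℕ) * x ^ (4:ℕ) * y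
          + J ^ (4:ℕ) * x ^ (4:ℕ) * y ^ (2:ℕ)
          = x ^ (3:ℕ) * ((4 : ℝ) * J ^ (2:ℕ) + (2 : ℝ) * J * (y / x) ^ (2:ℕ) - (4 : ℝ) * J ^ (2:ℕ) * (y / x) - (2 : ℝ) * J ^ (3:ℕ) + (4 : ℝ) * (y / x) ^ (3:ℕ)
              + (2 : ℝ) * J * (y / x) ^ (2:ℕ) * x - (4 : ℝ) * J * (y / x) ^ (3:ℕ) - (5 : ℝ) * J ^ (2:ℕ) * (y / x) * x - J ^ (2:ℕ) * (y / x) ^ (2:ℕ)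
              + (2 : ℝ) * J ^ (3:ℕ) * (y / x) - J ^ (3:ℕ) * x - (3 : ℝ) * J * (y / x) ^ (3:ℕ) * x + (4 : ℝ) * J ^ (2:ℕ) * (y / x) ^ (2:ℕ) * x + J ^ (2:ℕ) * (y / x) ^ (3:ℕ)
              + (4 : ℝ) * J ^ (3:ℕ) * (y / x) * x + J ^ (4:ℕ) * x - (4 : ℝ) * (y / x) ^ (4:ℕ) * x - (3 : ℝ) * J * (y / x) ^ (3:ℕ) * x ^ (2:ℕ) + (6 : ℝ) * J * (y / x) ^ (4:ℕ) * x
              + (2 : ℝ) * J ^ (2:ℕ) * (y / x) ^ (2:ℕ) * x ^ (2:ℕ) + (2 : ℝ) * J ^ (2:ℕ) * (y / x) ^ (3:ℕ) * x + (2 : ℝ) * J ^ (3:ℕ) * (y / x) * x ^ (2:ℕ)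
              - (4 : ℝ) * J ^ (3:ℕ) * (y / x) ^ (2:ℕ) * x + J * (y / x) ^ (4:ℕ) * x ^ (2:ℕ) + J ^ (2:ℕ) * (y / x) ^ (3:ℕ) * x ^ (2:ℕ) - (2 : ℝ) * J ^ (2:ℕ) * (y / x) ^ (4:ℕ) * x
              - (2 : ℝ) * J ^ (3:ℕ) * (y / x) ^ (2:ℕ) * x ^ (2:ℕ) - (2 : ℝ) * J ^ (4:ℕ) * (y / x) * x ^ (2:ℕ) + (y / x) ^ (5:ℕ) * x ^ (2:ℕ) + J * (y / x) ^ (4:ℕ) * x ^ (3:ℕ)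
              - (2 : ℝ) * J * (y / x) ^ (5:ℕ) * x ^ (2:ℕ) - J ^ (2:ℕ) * (y / x) ^ (4:ℕ) * x ^ (2:ℕ) - J ^ (3:ℕ) * (y / x) ^ (2:ℕ) * x ^ (3:ℕ)
              + (2 : ℝ) * J ^ (3:ℕ) * (y / x) ^ (3:ℕ) * x ^ (2:ℕ) - J ^ (2:ℕ) * (y / x) ^ (4:ℕ) * x ^ (3:ℕ) + J ^ (2:ℕ) * (y / x) ^ (5:ℕ) * x ^ (2:ℕ)
              + J ^ (4:ℕ) * (y / x) ^ (2:ℕ) * x ^ (3:ℕ)) := by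
        field_simp
        ring
      rw [key]; exact mul_nonneg (pow_nonneg hx0 3) h
  · rcases eq_or_lt_of_le hy0 with hy | hy
    · have hx : x = 0 := le_antisymm (hy ▸ hxy) hx0
      subst hx; rw [← hy]; norm_num
    · have ht0 : 0 ≤ x / y := div_nonneg hx0 hy0
      have ht1 : x / y ≤ 1 := (div_le_one hy).mpr hxy
      have h := wrook_rpB_nonneg (x / y) y J ht0 ht1 hy0 hy1 hJ0 hJ1
      have key : (4 : ℝ) * y ^ (3:ℕ) + (2 : ℝ) * J * x * y ^ (2:ℕ) - (4 : ℝ) * J * y ^ (3:ℕ) - (4 : ℝ) * y ^ (4:ℕ) - (3 : ℝ) * J * x * y ^ (3:ℕ)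
          + (2 : ℝ) * J * x ^ (2:ℕ) * y ^ (2:ℕ) + (6 : ℝ) * J * y ^ (4:ℕ) - J ^ (2:ℕ) * x * y ^ (2:ℕ) - (4 : ℝ) * J ^ (2:ℕ) * x ^ (2:ℕ) * y + (4 : ℝ) * J ^ (2:ℕ) * x ^ (3:ℕ)
          + J ^ (2:ℕ) * y ^ (3:ℕ) + y ^ (5:ℕ) + J * x * y ^ (4:ℕ) - (3 : ℝ) * J * x ^ (2:ℕ) * y ^ (3:ℕ) - (2 : ℝ) * J * y ^ (5:ℕ) + (2 : ℝ) * J ^ (2:ℕ) * x * y ^ (3:ℕ)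
          + (4 : ℝ) * J ^ (2:ℕ) * x ^ (2:ℕ) * y ^ (2:ℕ) - (5 : ℝ) * J ^ (2:ℕ) * x ^ (3:ℕ) * y - (2 : ℝ) * J ^ (2:ℕ) * y ^ (4:ℕ) + (2 : ℝ) * J ^ (3:ℕ) * x ^ (2:ℕ) * y
          - (2 : ℝ) * J ^ (3:ℕ) * x ^ (3:ℕ) + J * x ^ (2:ℕ) * y ^ (4:ℕ) - J ^ (2:ℕ) * x * y ^ (4:ℕ) + J ^ (2:ℕ) * x ^ (2:ℕ) * y ^ (3:ℕ)
          + (2 : ℝ) * J ^ (2:ℕ) * x ^ (3:ℕ) * y ^ (2:ℕ) + J ^ (2:ℕ) * y ^ (5:ℕ) - (4 : ℝ) * J ^ (3:ℕ) * x ^ (2:ℕ) * y ^ (2:ℕ) + (4 : ℝ) * J ^ (3:ℕ) * x ^ (3:ℕ) * y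
          - J ^ (3:ℕ) * x ^ (4:ℕ) - J ^ (2:ℕ) * x ^ (2:ℕ) * y ^ (4:ℕ) + (2 : ℝ) * J ^ (3:ℕ) * x ^ (2:ℕ) * y ^ (3:ℕ) - (2 : ℝ) * J ^ (3:ℕ) * x ^ (3:ℕ) * y ^ (2:ℕ)
          + (2 : ℝ) * J ^ (3:ℕ) * x ^ (4:ℕ) * y + J ^ (4:ℕ) * x ^ (4:ℕ) - J ^ (3:ℕ) * x ^ (4:ℕ) * y ^ (2:ℕ) - (2 : ℝ) * J ^ (4:ℕ) * x ^ (4:ℕ) * y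
          + J ^ (4:ℕ) * x ^ (4:ℕ) * y ^ (2:ℕ)
          = y ^ (3:ℕ) * ((4 : ℝ) - (4 : ℝ) * J - (4 : ℝ) * y + (2 : ℝ) * J * (x / y) + (6 : ℝ) * J * y + J ^ (2:ℕ) + y ^ (2:ℕ) - (3 : ℝ) * J * (x / y) * y
              - (2 : ℝ) * J * y ^ (2:ℕ) - J ^ (2:ℕ) * (x / y) - (2 : ℝ) * J ^ (2:ℕ) * y + J * (x / y) * y ^ (2:ℕ) + (2 : ℝ) * J * (x / y) ^ (2:ℕ) * y
              + (2 : ℝ) * J ^ (2:ℕ) * (x / y) * y - (4 : ℝ) * J ^ (2:ℕ) * (x / y) ^ (2:ℕ) + J ^ (2:ℕ) * y ^ (2:ℕ) - (3 : ℝ) * J * (x / y) ^ (2:ℕ) * y ^ (2:ℕ)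
              - J ^ (2:ℕ) * (x / y) * y ^ (2:ℕ) + (4 : ℝ) * J ^ (2:ℕ) * (x / y) ^ (2:ℕ) * y + (4 : ℝ) * J ^ (2:ℕ) * (x / y) ^ (3:ℕ) + (2 : ℝ) * J ^ (3:ℕ) * (x / y) ^ (2:ℕ)
              + J * (x / y) ^ (2:ℕ) * y ^ (3:ℕ) + J ^ (2:ℕ) * (x / y) ^ (2:ℕ) * y ^ (2:ℕ) - (5 : ℝ) * J ^ (2:ℕ) * (x / y) ^ (3:ℕ) * y - (4 : ℝ) * J ^ (3:ℕ) * (x / y) ^ (2:ℕ) * y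
              - (2 : ℝ) * J ^ (3:ℕ) * (x / y) ^ (3:ℕ) - J ^ (2:ℕ) * (x / y) ^ (2:ℕ) * y ^ (3:ℕ) + (2 : ℝ) * J ^ (2:ℕ) * (x / y) ^ (3:ℕ) * y ^ (2:ℕ)
              + (2 : ℝ) * J ^ (3:ℕ) * (x / y) ^ (2:ℕ) * y ^ (2:ℕ) + (4 : ℝ) * J ^ (3:ℕ) * (x / y) ^ (3:ℕ) * y - (2 : ℝ) * J ^ (3:ℕ) * (x / y) ^ (3:ℕ) * y ^ (2:ℕ)
              - J ^ (3:ℕ) * (x / y) ^ (4:ℕ) * y + (2 : ℝ) * J ^ (3:ℕ) * (x / y) ^ (4:ℕ) * y ^ (2:ℕ) + J ^ (4:ℕ) * (x / y) ^ (4:ℕ) * y - J ^ (3:ℕ) * (x / y) ^ (4:ℕ) * y ^ (3:ℕ)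
              - (2 : ℝ) * J ^ (4:ℕ) * (x / y) ^ (4:ℕ) * y ^ (2:ℕ) + J ^ (4:ℕ) * (x / y) ^ (4:ℕ) * y ^ (3:ℕ)) := by
        field_simp
        ring
      rw [key]; exact mul_nonneg (pow_nonneg hy0 3) h

/-- **`0 ≤ Rp′(u, v, J)` on the closed unit cube** `0 ≤ u, v, J ≤ 1`: substitute `x = 1 - u`,
`y = 1 - v` in `wrook_rp_xy_nonneg`. [folklore] -/
theorem wrook_rp_nonneg_cube (u v J : ℝ) (hu0 : 0 ≤ u) (hu1 : u ≤ 1) (hv0 : 0 ≤ v) (hv1 : v ≤ 1)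
    (hJ0 : 0 ≤ J) (hJ1 : J ≤ 1) :
    0 ≤ (1 : ℝ) - v + J ^ (2:ℕ) - (2 : ℝ) * v ^ (2:ℕ) - (3 : ℝ) * J * u * v + (2 : ℝ) * J * v ^ (2:ℕ) - (3 : ℝ) * J ^ (2:ℕ) * u - (2 : ℝ) * J ^ (2:ℕ) * v + (2 : ℝ) * v ^ (3:ℕ)
        + (3 : ℝ) * J * u * v ^ (2:ℕ) + J * u ^ (2:ℕ) * v - (2 : ℝ) * J * v ^ (3:ℕ) + (3 : ℝ) * J ^ (2:ℕ) * u * v + (3 : ℝ) * J ^ (2:ℕ) * u ^ (2:ℕ)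
        + (3 : ℝ) * J ^ (2:ℕ) * v ^ (2:ℕ) + v ^ (4:ℕ) + (3 : ℝ) * J * u * v ^ (3:ℕ) - J * u ^ (2:ℕ) * v ^ (2:ℕ) - (2 : ℝ) * J * v ^ (4:ℕ) - (7 : ℝ) * J ^ (2:ℕ) * u * v ^ (2:ℕ)
        - J ^ (2:ℕ) * u ^ (3:ℕ) + (2 : ℝ) * J ^ (2:ℕ) * v ^ (3:ℕ) - J ^ (3:ℕ) * v ^ (2:ℕ) - v ^ (5:ℕ) - (3 : ℝ) * J * u * v ^ (4:ℕ) - J * u ^ (2:ℕ) * v ^ (3:ℕ)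
        + (2 : ℝ) * J * v ^ (5:ℕ) - (8 : ℝ) * J ^ (2:ℕ) * u * v ^ (3:ℕ) + (7 : ℝ) * J ^ (2:ℕ) * u ^ (2:ℕ) * v ^ (2:ℕ) - J ^ (2:ℕ) * u ^ (3:ℕ) * v + J ^ (2:ℕ) * v ^ (4:ℕ)
        + (6 : ℝ) * J ^ (3:ℕ) * u * v ^ (2:ℕ) - (2 : ℝ) * J ^ (3:ℕ) * v ^ (3:ℕ) + J ^ (4:ℕ) * v ^ (2:ℕ) + J * u ^ (2:ℕ) * v ^ (4:ℕ) + (3 : ℝ) * J ^ (2:ℕ) * u * v ^ (4:ℕ)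
        + (3 : ℝ) * J ^ (2:ℕ) * u ^ (2:ℕ) * v ^ (3:ℕ) - (2 : ℝ) * J ^ (2:ℕ) * u ^ (3:ℕ) * v ^ (2:ℕ) - J ^ (2:ℕ) * v ^ (5:ℕ) + (4 : ℝ) * J ^ (3:ℕ) * u * v ^ (3:ℕ)
        - (10 : ℝ) * J ^ (3:ℕ) * u ^ (2:ℕ) * v ^ (2:ℕ) - (4 : ℝ) * J ^ (4:ℕ) * u * v ^ (2:ℕ) - J ^ (2:ℕ) * u ^ (2:ℕ) * v ^ (4:ℕ) - (2 : ℝ) * J ^ (3:ℕ) * u ^ (2:ℕ) * v ^ (3:ℕ)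
        + (6 : ℝ) * J ^ (3:ℕ) * u ^ (3:ℕ) * v ^ (2:ℕ) + (6 : ℝ) * J ^ (4:ℕ) * u ^ (2:ℕ) * v ^ (2:ℕ) - J ^ (3:ℕ) * u ^ (4:ℕ) * v ^ (2:ℕ)
        - (4 : ℝ) * J ^ (4:ℕ) * u ^ (3:ℕ) * v ^ (2:ℕ) + J ^ (4:ℕ) * u ^ (4:ℕ) * v ^ (2:ℕ) :=
  (wrook_rp_xy_nonneg (1 - u) (1 - v) J (by linarith) (by linarith) (by linarith) (by linarith)
    hJ0 hJ1).trans_eq (by ring)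

/-- `Da′` in the blown-down variables `x = 1 - u`, `y = 1 - v` is nonnegative on the unit cube:
if `y ≤ x` use the chart `y = t·x` (`wrook_daA_nonneg`, factor `x³ ≥ 0`), otherwise the chart `x = t·y`
(`wrook_daB_nonneg`, factor `y³ ≥ 0`). [folklore] -/
theorem wrook_da_xy_nonneg (x y J : ℝ) (hx0 : 0 ≤ x) (hx1 : x ≤ 1) (hy0 : 0 ≤ y) (hy1 : y ≤ 1)
    (hJ0 : 0 ≤ J) (hJ1 : J ≤ 1) :
    0 ≤ (4 : ℝ) * y ^ (3:ℕ) + J * x * y ^ (2:ℕ) - (2 : ℝ) * J * y ^ (3:ℕ) - (2 : ℝ) * y ^ (4:ℕ) - J * x * y ^ (3:ℕ) + J * x ^ (2:ℕ) * y ^ (2:ℕ) + (2 : ℝ) * J * y ^ (4:ℕ)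
        - (2 : ℝ) * J ^ (2:ℕ) * x ^ (2:ℕ) * y + (4 : ℝ) * J ^ (2:ℕ) * x ^ (3:ℕ) - J * x ^ (2:ℕ) * y ^ (3:ℕ) + J ^ (2:ℕ) * x ^ (2:ℕ) * y ^ (2:ℕ)
        - (3 : ℝ) * J ^ (2:ℕ) * x ^ (3:ℕ) * y - J ^ (3:ℕ) * x ^ (3:ℕ) + J ^ (2:ℕ) * x ^ (2:ℕ) * y ^ (3:ℕ) + J ^ (2:ℕ) * x ^ (3:ℕ) * y ^ (2:ℕ)
        + (2 : ℝ) * J ^ (3:ℕ) * x ^ (3:ℕ) * y - J ^ (3:ℕ) * x ^ (3:ℕ) * y ^ (2:ℕ) := by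
  rcases le_total y x with hyx | hxy
  · rcases eq_or_lt_of_le hx0 with hx | hx
    · have hy : y = 0 := le_antisymm (hx ▸ hyx) hy0
      subst hy; rw [← hx]; norm_num
    · have ht0 : 0 ≤ y / x := div_nonneg hy0 hx0
      have ht1 : y / x ≤ 1 := (div_le_one hx).mpr hyx
      have h := wrook_daA_nonneg x (y / x) J hx0 hx1 ht0 ht1 hJ0 hJ1
      have key : (4 : ℝ) * y ^ (3:ℕ) + J * x * y ^ (2:ℕ) - (2 : ℝ) * J * y ^ (3:ℕ) - (2 : ℝ) * y ^ (4:ℕ) - J * x * y ^ (3:ℕ) + J * x ^ (2:ℕ) * y ^ (2:ℕ) + (2 : ℝ) * J * y ^ (4:ℕ)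
          - (2 : ℝ) * J ^ (2:ℕ) * x ^ (2:ℕ) * y + (4 : ℝ) * J ^ (2:ℕ) * x ^ (3:ℕ) - J * x ^ (2:ℕ) * y ^ (3:ℕ) + J ^ (2:ℕ) * x ^ (2:ℕ) * y ^ (2:ℕ)
          - (3 : ℝ) * J ^ (2:ℕ) * x ^ (3:ℕ) * y - J ^ (3:ℕ) * x ^ (3:ℕ) + J ^ (2:ℕ) * x ^ (2:ℕ) * y ^ (3:ℕ) + J ^ (2:ℕ) * x ^ (3:ℕ) * y ^ (2:ℕ)
          + (2 : ℝ) * J ^ (3:ℕ) * x ^ (3:ℕ) * y - J ^ (3:ℕ) * x ^ (3:ℕ) * y ^ (2:ℕ)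
          = x ^ (3:ℕ) * ((4 : ℝ) * J ^ (2:ℕ) + J * (y / x) ^ (2:ℕ) - (2 : ℝ) * J ^ (2:ℕ) * (y / x) - J ^ (3:ℕ) + (4 : ℝ) * (y / x) ^ (3:ℕ) + J * (y / x) ^ (2:ℕ) * x
              - (2 : ℝ) * J * (y / x) ^ (3:ℕ) - (3 : ℝ) * J ^ (2:ℕ) * (y / x) * x - J * (y / x) ^ (3:ℕ) * x + J ^ (2:ℕ) * (y / x) ^ (2:ℕ) * x + (2 : ℝ) * J ^ (3:ℕ) * (y / x) * x
              - (2 : ℝ) * (y / x) ^ (4:ℕ) * x - J * (y / x) ^ (3:ℕ) * x ^ (2:ℕ) + (2 : ℝ) * J * (y / x) ^ (4:ℕ) * x + J ^ (2:ℕ) * (y / x) ^ (2:ℕ) * x ^ (2:ℕ)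
              + J ^ (2:ℕ) * (y / x) ^ (3:ℕ) * x ^ (2:ℕ) - J ^ (3:ℕ) * (y / x) ^ (2:ℕ) * x ^ (2:ℕ)) := by
        field_simp
        ring
      rw [key]; exact mul_nonneg (pow_nonneg hx0 3) h
  · rcases eq_or_lt_of_le hy0 with hy | hy
    · have hx : x = 0 := le_antisymm (hy ▸ hxy) hx0
      subst hx; rw [← hy]; norm_num
    · have ht0 : 0 ≤ x / y := div_nonneg hx0 hy0
      have ht1 : x / y ≤ 1 := (div_le_one hy).mpr hxy
      have h := wrook_daB_nonneg (x / y) y J ht0 ht1 hy0 hy1 hJ0 hJ1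
      have key : (4 : ℝ) * y ^ (3:ℕ) + J * x * y ^ (2:ℕ) - (2 : ℝ) * J * y ^ (3:ℕ) - (2 : ℝ) * y ^ (4:ℕ) - J * x * y ^ (3:ℕ) + J * x ^ (2:ℕ) * y ^ (2:ℕ) + (2 : ℝ) * J * y ^ (4:ℕ)
          - (2 : ℝ) * J ^ (2:ℕ) * x ^ (2:ℕ) * y + (4 : ℝ) * J ^ (2:ℕ) * x ^ (3:ℕ) - J * x ^ (2:ℕ) * y ^ (3:ℕ) + J ^ (2:ℕ) * x ^ (2:ℕ) * y ^ (2:ℕ)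
          - (3 : ℝ) * J ^ (2:ℕ) * x ^ (3:ℕ) * y - J ^ (3:ℕ) * x ^ (3:ℕ) + J ^ (2:ℕ) * x ^ (2:ℕ) * y ^ (3:ℕ) + J ^ (2:ℕ) * x ^ (3:ℕ) * y ^ (2:ℕ)
          + (2 : ℝ) * J ^ (3:ℕ) * x ^ (3:ℕ) * y - J ^ (3:ℕ) * x ^ (3:ℕ) * y ^ (2:ℕ)
          = y ^ (3:ℕ) * ((4 : ℝ) - (2 : ℝ) * J - (2 : ℝ) * y + J * (x / y) + (2 : ℝ) * J * y - J * (x / y) * y + J * (x / y) ^ (2:ℕ) * y - (2 : ℝ) * J ^ (2:ℕ) * (x / y) ^ (2:ℕ)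
              - J * (x / y) ^ (2:ℕ) * y ^ (2:ℕ) + J ^ (2:ℕ) * (x / y) ^ (2:ℕ) * y + (4 : ℝ) * J ^ (2:ℕ) * (x / y) ^ (3:ℕ) + J ^ (2:ℕ) * (x / y) ^ (2:ℕ) * y ^ (2:ℕ)
              - (3 : ℝ) * J ^ (2:ℕ) * (x / y) ^ (3:ℕ) * y - J ^ (3:ℕ) * (x / y) ^ (3:ℕ) + J ^ (2:ℕ) * (x / y) ^ (3:ℕ) * y ^ (2:ℕ) + (2 : ℝ) * J ^ (3:ℕ) * (x / y) ^ (3:ℕ) * y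
              - J ^ (3:ℕ) * (x / y) ^ (3:ℕ) * y ^ (2:ℕ)) := by
        field_simp
        ring
      rw [key]; exact mul_nonneg (pow_nonneg hy0 3) h

/-- **`0 ≤ Da′(u, v, J)` on the closed unit cube** `0 ≤ u, v, J ≤ 1`: substitute `x = 1 - u`,
`y = 1 - v` in `wrook_da_xy_nonneg`. [folklore] -/
theorem wrook_da_nonneg_cube (u v J : ℝ) (hu0 : 0 ≤ u) (hu1 : u ≤ 1) (hv0 : 0 ≤ v) (hv1 : v ≤ 1)
    (hJ0 : 0 ≤ J) (hJ1 : J ≤ 1) :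
    0 ≤ (2 : ℝ) - (4 : ℝ) * v + (2 : ℝ) * J ^ (2:ℕ) - (3 : ℝ) * J * u * v + (2 : ℝ) * J * v ^ (2:ℕ) - (6 : ℝ) * J ^ (2:ℕ) * u - (2 : ℝ) * J ^ (2:ℕ) * v + (4 : ℝ) * v ^ (3:ℕ)
        + (6 : ℝ) * J * u * v ^ (2:ℕ) + J * u ^ (2:ℕ) * v - (4 : ℝ) * J * v ^ (3:ℕ) + (3 : ℝ) * J ^ (2:ℕ) * u * v + (6 : ℝ) * J ^ (2:ℕ) * u ^ (2:ℕ)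
        + (5 : ℝ) * J ^ (2:ℕ) * v ^ (2:ℕ) - (2 : ℝ) * v ^ (4:ℕ) - (3 : ℝ) * J * u * v ^ (3:ℕ) - (2 : ℝ) * J * u ^ (2:ℕ) * v ^ (2:ℕ) + (2 : ℝ) * J * v ^ (4:ℕ)
        - (11 : ℝ) * J ^ (2:ℕ) * u * v ^ (2:ℕ) - (2 : ℝ) * J ^ (2:ℕ) * u ^ (3:ℕ) - J ^ (2:ℕ) * v ^ (3:ℕ) - J ^ (3:ℕ) * v ^ (2:ℕ) + J * u ^ (2:ℕ) * v ^ (3:ℕ)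
        + (2 : ℝ) * J ^ (2:ℕ) * u * v ^ (3:ℕ) + (7 : ℝ) * J ^ (2:ℕ) * u ^ (2:ℕ) * v ^ (2:ℕ) - J ^ (2:ℕ) * u ^ (3:ℕ) * v + (3 : ℝ) * J ^ (3:ℕ) * u * v ^ (2:ℕ)
        - J ^ (2:ℕ) * u ^ (2:ℕ) * v ^ (3:ℕ) - J ^ (2:ℕ) * u ^ (3:ℕ) * v ^ (2:ℕ) - (3 : ℝ) * J ^ (3:ℕ) * u ^ (2:ℕ) * v ^ (2:ℕ) + J ^ (3:ℕ) * u ^ (3:ℕ) * v ^ (2:ℕ) :=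
  (wrook_da_xy_nonneg (1 - u) (1 - v) J (by linarith) (by linarith) (by linarith) (by linarith)
    hJ0 hJ1).trans_eq (by ring)

end Summit.HubbardSuperconductivity.HubbardSuperconductivity.Theorems.AnisotropyChord.TwoMagnon
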